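import Summits.Ventures.HSemireg.WedgeHankelRecurrenceChebyshevMarkov
import Summits.Ventures.HSemireg.WedgeHankelRecurrenceInterlacing

/-!
# Venture HSemireg — **THE NODES OF CONSECUTIVE GAUSS–MARKOV RULES INTERLACE**: if `Σ_{j ≤ t} μ_j v_j^p = Σ_{l ≤ t+1} ν_l w_l^p` for `p ≤ 2t + 1` (two positive discrete representations
# of the same Markov parameters `s_0, …, s_{2t+1}`, the second with one more atom: `ν_l > 0`, nodes strictly increasing) then `w_0 < v_0 < w_1 < v_1 < ⋯ < v_t < w_{t+1}` — equivalently, the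
# zeros of the orthogonal polynomials of degrees `m` and `m + 1` of a Stieltjes moment sequence interlace; ELEMENTARY proof by the test polynomials `q · r_k`, `q = ∏(X − v_j)`,
# `r_k = ∏_{l ≠ k, k+1}(X − w_l)`

HONEST FRAMING. Part of the Lean index of the computation cell `pub-hsemireg` (seat p10 gen 41, Sunday typer «UNIFORM-IN-n»).  Real polynomials, finite sums and the intermediate value theorem only
(N239's `exists_root_Ioo_of_mul_eval_neg`, N251's pairing lemma pattern); no variety, no cohomology theory, no sheaf, no Ext group and no semiregularity map is constructed here; nothing here
says that HC / HC_CM / HC_AV holds; no Literature fact (unproved `Prop`) is declared or used.  Custodian versions as in `WedgeHankelSiegelIdeal` (1/3).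
SOURCES (cited).  G. Szegő, *Orthogonal Polynomials*, AMS Colloq. Publ. 23, Thm 3.3.2 («the zeros of `p_n(x)` and `p_{n+1}(x)` separate each other») with §3.4 (Gauss–Jacobi mechanical
quadrature: the `n`-point rule with the zeros of `p_n` as nodes is exact in degree `≤ 2n − 1`); M. G. Krein, A. A. Nudel'man, *The Markov Moment Problem and Extremal Problems* (1977), Ch. III
(canonical representations, interlacing of their roots); F. R. Gantmacher, *The Theory of Matrices* II, Ch. XV §16 Thm 18 (the `m`-atomic representation of `s_0, …, s_{2m−1}`, typed N235).
PROOF TYPED HERE.  Both rules integrate every polynomial of degree `≤ 2t + 1` identically (`sum_mul_eval_eq_of_moments_eq`).  With `q = ∏_j (X − v_j)` and, for adjacent big nodes `w_a < w_b`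
(`a = k`, `b = k + 1`), `r = ∏_{l ≠ a, b} (X − w_l)` (degree `t`): `0 = Σ_j μ_j (q r)(v_j) = Σ_l ν_l (q r)(w_l) = ν_a q(w_a) r(w_a) + ν_b q(w_b) r(w_b)`, and `r(w_a) r(w_b) > 0` (each remaining
node lies on the same side of both), so `q(w_a) q(w_b) ≤ 0`, with `q(w_a) = 0 ⟺ q(w_b) = 0`; a vanishing would propagate to all `t + 2` big nodes, impossible for `deg q = t + 1`; hence
`q(w_k) q(w_{k+1}) < 0`, a root of `q` in each gap, and these `t + 1` increasing roots are the `v_k` in order.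
DEDUP DISCLOSURE (`rg -n 'interlac|Gauss' Summits/Ventures/HSemireg`, 2026-09-02): N239 ∕ N240 (interlacing of the roots of `h` and `g` of a positive pair — a different pair of polynomials);
nothing on two representations of the same moments.  The 7 names below: 0 hits tree-wide.

WHAT IS IN THE TREE.  N239 `exists_root_Ioo_of_mul_eval_neg`, `roots_C_mul_prod_X_sub_C`; Mathlib `Polynomial.eval_eq_sum_range'`, `Fintype.sum_eq_add`, `StrictMono.range_inj`,
`Finset.eq_of_subset_of_card_le`, `Polynomial.eq_zero_of_natDegree_lt_card_of_eval_eq_zero`.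
THIS FILE (namespace `Summit.Ventures.HSemireg.Wedge.HankelOuter` continued; CHAINED on N251 + N239; 0 definitions):
* §1027 `sum_mul_eval_eq_of_moments_eq` (equal moments up to `2t+1` ⇒ equal quadratures in degree `≤ 2t+1`), `eval_gapPoly_mul_eval_gapPoly_pos` (`r(w_a) r(w_b) > 0`),
  `sum_pair_eq_zero_of_moments_eq` (the two-term relation), `eval_nodePoly_eq_zero_iff_succ` (vanishing propagates), `eval_nodePoly_bigNode_ne_zero` (no common node),
  `eval_nodePoly_mul_eval_nodePoly_succ_neg` (strict alternation), **`gauss_nodes_interlace`** (`w_k < v_k < w_{k+1}` for all `k`).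
CAVEATS.  Nothing Ext-side.  New names only.
-/

open Module Polynomial
open scoped Matrix Polynomial

namespace Summit.Ventures.HSemireg.Wedge.HankelOuter

/-! ## §1027. Interlacing of the nodes of consecutive rules -/

/-- **Equal moments up to `2t + 1` ⇒ equal quadratures**: if `Σ_j μ_j v_j^p = Σ_l ν_l w_l^p` for `p ≤ N − 1` then `Σ_j μ_j F(v_j) = Σ_l ν_l F(w_l)` for every `F` with `deg F < N`.
[Szegő §3.4 (Gauss–Jacobi quadrature); this file, §1027] -/
theorem sum_mul_eval_eq_of_moments_eq {m m' N : ℕ} {μ v : Fin m → ℝ} {ν w : Fin m' → ℝ} (hmom : ∀ p, p < N → ∑ j, μ j * v j ^ p = ∑ l, ν l * w l ^ p) {F : ℝ[X]} (hF : F.natDegree < N) :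
    ∑ j, μ j * F.eval (v j) = ∑ l, ν l * F.eval (w l) := by
  have hev : ∀ y : ℝ, F.eval y = ∑ p ∈ Finset.range N, F.coeff p * y ^ p := fun y => eval_eq_sum_range' hF y
  simp_rw [hev, Finset.mul_sum]
  rw [Finset.sum_comm, Finset.sum_comm (f := fun l p => ν l * (F.coeff p * w l ^ p))]
  refine Finset.sum_congr rfl fun p hp => ?_
  have h := hmom p (Finset.mem_range.1 hp)
  calc ∑ j, μ j * (F.coeff p * v j ^ p) = F.coeff p * ∑ j, μ j * v j ^ p := by rw [Finset.mul_sum]; exact Finset.sum_congr rfl fun j _ => by ring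
    _ = F.coeff p * ∑ l, ν l * w l ^ p := by rw [h]
    _ = ∑ l, ν l * (F.coeff p * w l ^ p) := by rw [Finset.mul_sum]; exact Finset.sum_congr rfl fun l _ => by ring

/-- **The gap polynomial has the same sign at two adjacent nodes**: for strictly increasing `w` and `r = ∏_{l ≠ k, k+1} (X − w_l)`, `r(w_k) · r(w_{k+1}) > 0` (every other node is either below
both or above both). [folklore; this file, §1027] -/
theorem eval_gapPoly_mul_eval_gapPoly_pos {t : ℕ} {w : Fin (t + 2) → ℝ} (hw : StrictMono w) (k : Fin (t + 1)) :
    0 < (∏ l ∈ Finset.univ.filter (fun l : Fin (t + 2) => l ≠ k.castSucc ∧ l ≠ k.succ), (Polynomial.X - C (w l))).eval (w k.castSucc)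
      * (∏ l ∈ Finset.univ.filter (fun l : Fin (t + 2) => l ≠ k.castSucc ∧ l ≠ k.succ), (Polynomial.X - C (w l))).eval (w k.succ) := by
  rw [eval_prod, eval_prod, ← Finset.prod_mul_distrib]
  refine Finset.prod_pos fun l hl => ?_
  simp only [Finset.mem_filter, Finset.mem_univ, true_and] at hl
  simp only [eval_sub, eval_X, eval_C]
  rcases lt_or_gt_of_ne hl.1 with h1 | h1
  · -- `l < k`: both differences positive
    have h2 : l < k.succ := h1.trans (Fin.castSucc_lt_succ (i := k))
    exact mul_pos (sub_pos.2 (hw h1)) (sub_pos.2 (hw h2))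
  · -- `l > k + 1`: both differences negative
    have h2 : k.succ < l := lt_of_le_of_ne (Fin.castSucc_lt_iff_succ_le.1 h1) (Ne.symm hl.2)
    exact mul_pos_of_neg_of_neg (sub_neg.2 (hw h1)) (sub_neg.2 (hw h2))

/-- **The two-term relation**: with `q = ∏_j (X − v_j)`, `r_k` the gap polynomial and equal moments up to `2t + 1`,
`ν_k q(w_k) r_k(w_k) + ν_{k+1} q(w_{k+1}) r_k(w_{k+1}) = 0`. [Szegő Thm 3.3.2, mechanism; this file, §1027] -/
theorem sum_pair_eq_zero_of_moments_eq {t : ℕ} {μ v : Fin (t + 1) → ℝ} {ν : Fin (t + 2) → ℝ} {w : Fin (t + 2) → ℝ}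
    (hmom : ∀ p, p ≤ 2 * t + 1 → ∑ j, μ j * v j ^ p = ∑ l, ν l * w l ^ p) (k : Fin (t + 1)) :
    ν k.castSucc * ((∏ j, (Polynomial.X - C (v j))).eval (w k.castSucc)
        * (∏ l ∈ Finset.univ.filter (fun l : Fin (t + 2) => l ≠ k.castSucc ∧ l ≠ k.succ), (Polynomial.X - C (w l))).eval (w k.castSucc))
      + ν k.succ * ((∏ j, (Polynomial.X - C (v j))).eval (w k.succ)
        * (∏ l ∈ Finset.univ.filter (fun l : Fin (t + 2) => l ≠ k.castSucc ∧ l ≠ k.succ), (Polynomial.X - C (w l))).eval (w k.succ)) = 0 := by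
  classical
  set q : ℝ[X] := ∏ j, (Polynomial.X - C (v j)) with hq
  set r : ℝ[X] := ∏ l ∈ Finset.univ.filter (fun l : Fin (t + 2) => l ≠ k.castSucc ∧ l ≠ k.succ), (Polynomial.X - C (w l)) with hr
  -- degrees
  have hqdeg : q.natDegree = t + 1 := by
    rw [hq, natDegree_prod_of_monic _ _ fun j _ => monic_X_sub_C (v j)]
    simp only [natDegree_X_sub_C, Finset.sum_const, Finset.card_univ, Fintype.card_fin, smul_eq_mul, mul_one]
  have hcard : (Finset.univ.filter (fun l : Fin (t + 2) => l ≠ k.castSucc ∧ l ≠ k.succ)).card = t := by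
    have hne : k.castSucc ≠ k.succ := (Fin.castSucc_lt_succ (i := k)).ne
    have h1 : Finset.univ.filter (fun l : Fin (t + 2) => l ≠ k.castSucc ∧ l ≠ k.succ) = (Finset.univ.erase k.castSucc).erase k.succ := by
      ext l
      simp only [Finset.mem_filter, Finset.mem_univ, true_and, Finset.mem_erase]
      tauto
    rw [h1, Finset.card_erase_of_mem (Finset.mem_erase.2 ⟨hne.symm, Finset.mem_univ _⟩), Finset.card_erase_of_mem (Finset.mem_univ _), Finset.card_univ, Fintype.card_fin]
    rfl
  have hrdeg : r.natDegree = t := by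
    rw [hr, natDegree_prod_of_monic _ _ fun l _ => monic_X_sub_C (w l)]
    simp only [natDegree_X_sub_C, Finset.sum_const, hcard, smul_eq_mul, mul_one]
  have hdeg : (q * r).natDegree < 2 * t + 2 := by
    rw [natDegree_mul (monic_prod_of_monic _ _ fun j _ => monic_X_sub_C (v j)).ne_zero (monic_prod_of_monic _ _ fun l _ => monic_X_sub_C (w l)).ne_zero, hqdeg, hrdeg]
    omega
  -- the quadrature identity for `q r`
  have hquad := sum_mul_eval_eq_of_moments_eq (N := 2 * t + 2) (fun p hp => hmom p (by omega)) hdeg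
  -- the small rule kills `q r`
  have hsmall : ∑ j, μ j * (q * r).eval (v j) = 0 := by
    refine Finset.sum_eq_zero fun j _ => ?_
    have hq0 : q.eval (v j) = 0 := by
      rw [hq, eval_prod]
      exact Finset.prod_eq_zero (Finset.mem_univ j) (by simp)
    rw [eval_mul, hq0, zero_mul, mul_zero]
  -- the big rule: only the two adjacent nodes survive
  rw [hsmall] at hquad
  have hne : k.castSucc ≠ k.succ := (Fin.castSucc_lt_succ (i := k)).ne
  have hbig : ∑ l, ν l * (q * r).eval (w l) = ν k.castSucc * (q * r).eval (w k.castSucc) + ν k.succ * (q * r).eval (w k.succ) := by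
    refine Fintype.sum_eq_add _ _ hne fun l hl => ?_
    have hr0 : r.eval (w l) = 0 := by
      rw [hr, eval_prod]
      exact Finset.prod_eq_zero (Finset.mem_filter.2 ⟨Finset.mem_univ l, hl⟩) (by simp)
    rw [eval_mul, hr0, mul_zero, mul_zero]
  rw [hbig, eval_mul, eval_mul] at hquad
  exact hquad.symm

/-- **Vanishing propagates along the big nodes**: under the two-term relations, `q(w_k) = 0 ⟺ q(w_{k+1}) = 0`. [mechanism; this file, §1027] -/
theorem eval_nodePoly_eq_zero_iff_succ {t : ℕ} {μ v : Fin (t + 1) → ℝ} {ν w : Fin (t + 2) → ℝ} (hν : ∀ l, 0 < ν l) (hw : StrictMono w)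
    (hmom : ∀ p, p ≤ 2 * t + 1 → ∑ j, μ j * v j ^ p = ∑ l, ν l * w l ^ p) (k : Fin (t + 1)) :
    (∏ j, (Polynomial.X - C (v j))).eval (w k.castSucc) = 0 ↔ (∏ j, (Polynomial.X - C (v j))).eval (w k.succ) = 0 := by
  have hrel := sum_pair_eq_zero_of_moments_eq hmom k
  have hrr := eval_gapPoly_mul_eval_gapPoly_pos hw k
  have hra : (∏ l ∈ Finset.univ.filter (fun l : Fin (t + 2) => l ≠ k.castSucc ∧ l ≠ k.succ), (Polynomial.X - C (w l))).eval (w k.castSucc) ≠ 0 :=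
    fun h => by rw [h, zero_mul] at hrr; exact lt_irrefl _ hrr
  have hrb : (∏ l ∈ Finset.univ.filter (fun l : Fin (t + 2) => l ≠ k.castSucc ∧ l ≠ k.succ), (Polynomial.X - C (w l))).eval (w k.succ) ≠ 0 :=
    fun h => by rw [h, mul_zero] at hrr; exact lt_irrefl _ hrr
  constructor
  · intro h0
    rw [h0, zero_mul, mul_zero, zero_add] at hrel
    rcases mul_eq_zero.1 hrel with h | h
    · exact absurd h (hν _).ne'
    · rcases mul_eq_zero.1 h with h | h
      · exact h
      · exact absurd h hrb
  · intro h0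
    rw [h0, zero_mul, mul_zero, add_zero] at hrel
    rcases mul_eq_zero.1 hrel with h | h
    · exact absurd h (hν _).ne'
    · rcases mul_eq_zero.1 h with h | h
      · exact h
      · exact absurd h hra

/-- **The two rules have no common node**: `q(w_l) ≠ 0` for every big node (otherwise `q`, of degree `t + 1`, would vanish at all `t + 2` big nodes). [Szegő Thm 3.3.2; this file, §1027] -/
theorem eval_nodePoly_bigNode_ne_zero {t : ℕ} {μ v : Fin (t + 1) → ℝ} {ν w : Fin (t + 2) → ℝ} (hν : ∀ l, 0 < ν l) (hw : StrictMono w)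
    (hmom : ∀ p, p ≤ 2 * t + 1 → ∑ j, μ j * v j ^ p = ∑ l, ν l * w l ^ p) (l : Fin (t + 2)) :
    (∏ j, (Polynomial.X - C (v j))).eval (w l) ≠ 0 := by
  intro hl
  -- propagate the vanishing to `w_0`, then to every node
  have hiff : ∀ i : Fin (t + 2), (∏ j, (Polynomial.X - C (v j))).eval (w i) = 0 ↔ (∏ j, (Polynomial.X - C (v j))).eval (w 0) = 0 := fun i =>
    Fin.induction (motive := fun i : Fin (t + 2) => (∏ j, (Polynomial.X - C (v j))).eval (w i) = 0 ↔ (∏ j, (Polynomial.X - C (v j))).eval (w 0) = 0) Iff.rfl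
      (fun i ih => (eval_nodePoly_eq_zero_iff_succ hν hw hmom i).symm.trans ih) i
  have hall : ∀ i : Fin (t + 2), (∏ j, (Polynomial.X - C (v j))).eval (w i) = 0 := fun i => (hiff i).2 ((hiff l).1 hl)
  have hq0 := eq_zero_of_natDegree_lt_card_of_eval_eq_zero (∏ j, (Polynomial.X - C (v j))) hw.injective hall (by
    rw [natDegree_prod_of_monic _ _ fun j _ => monic_X_sub_C (v j)]
    simp only [natDegree_X_sub_C, Finset.sum_const, Finset.card_univ, Fintype.card_fin, smul_eq_mul, mul_one]
    omega)
  exact (monic_prod_of_monic _ _ fun j _ => monic_X_sub_C (v j)).ne_zero hq0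

/-- **Strict alternation of `q` along the big nodes**: `q(w_k) · q(w_{k+1}) < 0`. [Szegő Thm 3.3.2; this file, §1027] -/
theorem eval_nodePoly_mul_eval_nodePoly_succ_neg {t : ℕ} {μ v : Fin (t + 1) → ℝ} {ν w : Fin (t + 2) → ℝ} (hν : ∀ l, 0 < ν l) (hw : StrictMono w)
    (hmom : ∀ p, p ≤ 2 * t + 1 → ∑ j, μ j * v j ^ p = ∑ l, ν l * w l ^ p) (k : Fin (t + 1)) :
    (∏ j, (Polynomial.X - C (v j))).eval (w k.castSucc) * (∏ j, (Polynomial.X - C (v j))).eval (w k.succ) < 0 := by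
  have hrel := sum_pair_eq_zero_of_moments_eq hmom k
  have hrr := eval_gapPoly_mul_eval_gapPoly_pos hw k
  have ha := eval_nodePoly_bigNode_ne_zero hν hw hmom k.castSucc
  have hb := eval_nodePoly_bigNode_ne_zero hν hw hmom k.succ
  set qa := (∏ j, (Polynomial.X - C (v j))).eval (w k.castSucc)
  set qb := (∏ j, (Polynomial.X - C (v j))).eval (w k.succ)
  set ra := (∏ l ∈ Finset.univ.filter (fun l : Fin (t + 2) => l ≠ k.castSucc ∧ l ≠ k.succ), (Polynomial.X - C (w l))).eval (w k.castSucc)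
  set rb := (∏ l ∈ Finset.univ.filter (fun l : Fin (t + 2) => l ≠ k.castSucc ∧ l ≠ k.succ), (Polynomial.X - C (w l))).eval (w k.succ)
  -- `ν_a qa ra = −ν_b qb rb` ⇒ `(qa qb)(ra rb) ν_a ν_b = −(ν_b qb rb)² < 0`
  have hsq : 0 < (ν k.succ * (qb * rb)) ^ 2 := by
    have hne : ν k.succ * (qb * rb) ≠ 0 := mul_ne_zero (hν _).ne' (mul_ne_zero hb fun h => by rw [h, mul_zero] at hrr; exact lt_irrefl _ hrr)
    positivity
  have hid : (qa * qb) * (ra * rb * (ν k.castSucc * ν k.succ)) = -(ν k.succ * (qb * rb)) ^ 2 := by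
    have h1 : ν k.castSucc * (qa * ra) = -(ν k.succ * (qb * rb)) := by linarith
    linear_combination (ν k.succ * (qb * rb)) * h1
  have hneg : (qa * qb) * (ra * rb * (ν k.castSucc * ν k.succ)) < 0 := by rw [hid]; linarith
  have hpos : 0 < ra * rb * (ν k.castSucc * ν k.succ) := mul_pos hrr (mul_pos (hν _) (hν _))
  by_contra hcon
  exact absurd hneg (not_lt.2 (mul_nonneg (not_lt.1 hcon) hpos.le))

/-- **THE NODES OF CONSECUTIVE RULES INTERLACE** (zeros of consecutive orthogonal polynomials separate each other): if `Σ_{j ≤ t} μ_j v_j^p = Σ_{l ≤ t+1} ν_l w_l^p` for all `p ≤ 2t + 1` with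
`v`, `w` strictly increasing and `ν_l > 0`, then `w_k < v_k < w_{k+1}` for every `k ≤ t`. [Szegő Thm 3.3.2 with §3.4; Krein–Nudel'man Ch. III; this file, §1027] -/
theorem gauss_nodes_interlace {t : ℕ} {μ v : Fin (t + 1) → ℝ} {ν w : Fin (t + 2) → ℝ} (hv : StrictMono v) (hν : ∀ l, 0 < ν l) (hw : StrictMono w)
    (hmom : ∀ p, p ≤ 2 * t + 1 → ∑ j, μ j * v j ^ p = ∑ l, ν l * w l ^ p) (k : Fin (t + 1)) :
    w k.castSucc < v k ∧ v k < w k.succ := by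
  classical
  -- a root of `q` in each gap
  have hgap : ∀ i : Fin (t + 1), ∃ z, w i.castSucc < z ∧ z < w i.succ ∧ (∏ j, (Polynomial.X - C (v j))).IsRoot z := fun i =>
    exists_root_Ioo_of_mul_eval_neg (hw (Fin.castSucc_lt_succ (i := i))) (eval_nodePoly_mul_eval_nodePoly_succ_neg hν hw hmom i)
  choose z hz1 hz2 hz3 using hgap
  -- `z` is strictly increasing and takes values among the `v_j`
  have hzmono : StrictMono z := by
    refine Fin.strictMono_iff_lt_succ.2 fun i => ?_
    calc z i.castSucc < w i.castSucc.succ := hz2 _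
      _ = w i.succ.castSucc := by rw [Fin.succ_castSucc]
      _ < z i.succ := hz1 _
  have hzmem : ∀ i, z i ∈ Set.range v := fun i => by
    have h := hz3 i
    rw [IsRoot.def, eval_prod, Finset.prod_eq_zero_iff] at h
    obtain ⟨j, -, hj⟩ := h
    rw [eval_sub, eval_X, eval_C, sub_eq_zero] at hj
    exact ⟨j, hj.symm⟩
  have hrange : Set.range z = Set.range v := by
    have hsub : Finset.univ.image z ⊆ Finset.univ.image v := by
      intro x hx
      obtain ⟨i, -, rfl⟩ := Finset.mem_image.1 hx
      obtain ⟨j, hj⟩ := hzmem i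
      exact Finset.mem_image.2 ⟨j, Finset.mem_univ _, hj⟩
    have hcard : (Finset.univ.image v).card ≤ (Finset.univ.image z).card := by
      rw [Finset.card_image_of_injective _ hv.injective, Finset.card_image_of_injective _ hzmono.injective]
    have heq := Finset.eq_of_subset_of_card_le hsub hcard
    rw [← Set.image_univ, ← Set.image_univ, ← Finset.coe_univ, ← Finset.coe_image, ← Finset.coe_image, heq]
  have hzv : z = v := (hzmono.range_inj hv).1 hrange
  rw [← hzv]
  exact ⟨hz1 k, hz2 k⟩

end Summit.Ventures.HSemireg.Wedge.HankelOuter
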